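import Summits.QuantumAdvantage.QuantumAdvantage.Theorems.WbwObfuscatedGluedTreesKowVocabulary
import Summits.QuantumAdvantage.QuantumAdvantage.Theorems.WbwObfuscatedGluedTreesKowCoinNormalisation
import Summits.QuantumAdvantage.QuantumAdvantage.Theorems.WbwObfuscatedGluedTreesKowBpsKeyedStep

/-!
# `WbwObfuscatedGluedTrees` (stmt-QuantumAdvantage-2340) — line `knowledge-of-walk-split`, stub `stub_bestPossibleStep` III: the stub

The registered stub `stub_bestPossibleStep` of the skeleton
`Cruxes/WbwObfuscatedGluedTrees/Lines/knowledge-of-walk-split.lean` (lead's reshape, cycle 1): for key-indexed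
families `C₀ k ≡ C₁ k` (same arity, size and function, both in `ppolyCircuits (κ n)`), a schedule
`n^c ≤ κ n ≤ poly(n)`, polynomially bounded instance/name/answer lengths and a sub-exponentially secure iO `O`,
clause (C) for the obfuscations of `C₁` implies clause (C) for the obfuscations of `C₀`.

Proof: fix a PPT `A` against `genObf O κ h m C₀ nm`; normalise its coin budget (`CoinNormalisation.norm`, loss
polynomial in `n` because the instances have polynomial length, `exists_poly_length_inst`); rewrite both success
sequences by the seed law (`succ_eq_key_coins`: uniform key `k = s ↾ h n`, uniform obfuscator coins
`r = (s ⇂ h n) ↾ coins`); the per-key gap is the advised iO advantage of the distinguisher of file I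
(`gap_eq_ioAdvantageAdv`), bounded by `2^{-(κ n)^ε} ≤ 2^{-n^{cε}}` uniformly in the key for large `n` (file II,
`eventually_ioAdvantageAdv_le`); average over the key (`SeedLaw.abs_uniformAvg_sub_le`); conclude with the
`SuperpolynomialDecay` algebra (`.add`, `.polynomial_mul`, `.trans_eventually_abs_le`).
-/

set_option linter.dupNamespace false

namespace Summit.QuantumAdvantage.QuantumAdvantage.Theorems.WbwObfuscatedGluedTrees.KnowledgeOfWalk

open Literature.Computability.Cryptography Literature.Computability.Complexity
open _root_.Computability Polynomial Filter Asymptotics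
open Summit.QuantumAdvantage.QuantumAdvantage.Theorems.WbwObfuscatedGluedTrees.Negative (ClauseC)

namespace BestPossibleStep

/-! ### Padding a key to a seed -/

/-- A seed of length `n` with key `k`: pad with zeros. [folklore] -/
def padSeed (n : ℕ) (k : List Bool) : List Bool := k ++ List.replicate (n - k.length) false

/-- The padded seed has length `n` when `|k| ≤ n`. [folklore] -/
theorem length_padSeed {n : ℕ} {k : List Bool} (hk : k.length ≤ n) : (padSeed n k).length = n := by
  simp [padSeed]; omega

/-- The key of the padded seed is `k`. [folklore] -/
theorem take_padSeed (n : ℕ) (k : List Bool) : (padSeed n k).take k.length = k := by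
  simp [padSeed]

/-- A per-seed hypothesis, read at the padded seed of a key `k ∈ {0,1}^{h n}` (`h n ≤ n`), is a per-key
hypothesis at level `n`. [folklore] -/
theorem of_seed {h : ℕ → ℕ} (hh : ∀ n, h n ≤ n) {P : ℕ → List Bool → Prop}
    (hP : ∀ s : List Bool, P s.length (s.take (h s.length))) {n : ℕ} {k : List Bool} (hk : k.length = h n) :
    P n k := by
  have hlen : (padSeed n k).length = n := length_padSeed (hk ▸ hh n)
  have := hP (padSeed n k)
  rwa [hlen, ← hk, take_padSeed] at this

/-- The same from an EVENTUAL per-seed hypothesis (`n₀ ≤ |s|`), at levels `n ≥ n₀`. [folklore] -/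
theorem of_seed_ge {h : ℕ → ℕ} (hh : ∀ n, h n ≤ n) {P : ℕ → List Bool → Prop} {n₀ : ℕ}
    (hP : ∀ s : List Bool, n₀ ≤ s.length → P s.length (s.take (h s.length))) {n : ℕ} {k : List Bool}
    (hn : n₀ ≤ n) (hk : k.length = h n) : P n k := by
  have hlen : (padSeed n k).length = n := length_padSeed (hk ▸ hh n)
  have := hP (padSeed n k) (by rw [hlen]; exact hn)
  rwa [hlen, ← hk, take_padSeed] at this

/-! ### The success sequence of an adversary against `genObf` and its seed law -/

/-- The success probability of `A` against `genObf O κ h m C nm` / `keyed h ans` at level `n` (the quantity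
clause (C) asks to decay). [folklore] -/
noncomputable def succ (O : CircuitObfuscator) (κ h : ℕ → ℕ) (m : List Bool → ℕ)
    (C : (k : List Bool) → Circuit (Fin (m k))) (nm ans : List Bool → List Bool)
    (A : RandAlg (List Bool) (List Bool)) (n : ℕ) : ℝ :=
  uniformAvg n fun s => A.pr id (boolPair (unaryEncodeNat n) (genObf O κ h m C nm s)) {y | keyed h ans s <+: y}

/-- Clause (C) for `(genObf …, keyed …)` is superpolynomial decay of `succ` for every PPT. [folklore] -/
theorem clauseC_iff (O : CircuitObfuscator) (κ h : ℕ → ℕ) (m : List Bool → ℕ)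
    (C : (k : List Bool) → Circuit (Fin (m k))) (nm ans : List Bool → List Bool) :
    ClauseC (genObf O κ h m C nm) (keyed h ans) ↔
      ∀ A : RandAlg (List Bool) (List Bool), IsPPT A id →
        SuperpolynomialDecay atTop (fun n : ℕ => (n : ℝ)) (succ O κ h m C nm ans A) :=
  Iff.rfl

/-- `succ` is nonnegative. [folklore] -/
theorem succ_nonneg (O : CircuitObfuscator) (κ h : ℕ → ℕ) (m : List Bool → ℕ)
    (C : (k : List Bool) → Circuit (Fin (m k))) (nm ans : List Bool → List Bool)
    (A : RandAlg (List Bool) (List Bool)) (n : ℕ) : 0 ≤ succ O κ h m C nm ans A n :=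
  uniformAvg_nonneg fun _ => RandAlg.pr_nonneg _ _ _ _

/-- **Seed law for `succ`**: a uniform key and uniform obfuscator coins. [folklore] -/
theorem succ_eq_key_coins (O : CircuitObfuscator) (κ h : ℕ → ℕ) (m : List Bool → ℕ)
    (C : (k : List Bool) → Circuit (Fin (m k))) (nm ans : List Bool → List Bool)
    (A : RandAlg (List Bool) (List Bool)) (hh : ∀ n, h n ≤ n) (n : ℕ)
    (hcoins : ∀ k : List Bool, k.length = h n → O.coins (κ n) (C k) ≤ n - h n) :
    succ O κ h m C nm ans A n =
      uniformAvg (h n) fun k => uniformAvg (O.coins (κ n) (C k)) fun r =>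
        A.pr id (xInst O κ m C nm n k r) {y | ans k <+: y} := by
  refine SeedLaw.uniformAvg_eq_key_coins (hh n) (fun k => O.coins (κ n) (C k)) hcoins _ _ fun s hs => ?_
  subst hs
  rfl

/-! ### Instance lengths are polynomial -/

/-- **The obfuscated instances have polynomial length** (efficiency of `O` on codes, the schedule bound
`κ ≤ p` and the clear-instance length bound; obfuscator coins of length `≤ n`). [folklore] -/
theorem exists_poly_length_inst {O : CircuitObfuscator} (hO : O.IsEfficient) (κ h : ℕ → ℕ) (m : List Bool → ℕ)
    (C : (k : List Bool) → Circuit (Fin (m k))) (nm : List Bool → List Bool)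
    (hκhi : ∃ p : Polynomial ℕ, ∀ n, κ n ≤ p.eval n) (hh : ∀ n, h n ≤ n)
    (hq : ∃ q : Polynomial ℕ, ∀ s : List Bool, (genClear h m C nm s).length ≤ q.eval s.length) :
    ∃ P : Polynomial ℕ, ∀ (n : ℕ) (k r : List Bool), k.length = h n → r.length ≤ n →
      (xInst O κ m C nm n k r).length ≤ P.eval n := by
  obtain ⟨Ob, hOb, hObrun⟩ := FPExtension.exists_FP_obf hO
  obtain ⟨sOb, hsOb⟩ := FPExtension.exists_poly_length_le hOb
  obtain ⟨p, hp⟩ := hκhi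
  obtain ⟨q, hq⟩ := hq
  refine ⟨2 * X + 4 + 2 * sOb.comp (4 * p + 6 + 2 * q + X) + q, fun n k r hk hr => ?_⟩
  -- the clear data at the padded seed
  have hclear : (boolPair (encodeSizedCircuit ⟨m k, C k⟩) (nm k)).length ≤ q.eval n :=
    of_seed (P := fun n k => (boolPair (encodeSizedCircuit ⟨m k, C k⟩) (nm k)).length ≤ q.eval n) hh
      (fun s => hq s) hk
  rw [length_boolPair] at hclear
  -- the obfuscated code is `Ob` of an input of polynomial length
  have hcode : (encodeSizedCircuit ⟨m k, O.obf (κ n) (C k) r⟩).length ≤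
      sOb.eval (4 * p.eval n + 6 + 2 * q.eval n + n) := by
    rw [← hObrun]
    refine (hsOb _).trans (SeedLaw.natPoly_eval_mono _ ?_)
    simp only [length_boolPair, length_unaryEncodeNat]
    have := hp n
    omega
  simp only [xInst, length_boolPair, length_unaryEncodeNat, eval_add, eval_mul, eval_ofNat, eval_X, eval_comp]
  omega

/-! ### The stub -/

/-- **STUB `stub_bestPossibleStep` (registered; the best-possible step).**  For key-indexed families
`C₀ k ≡ C₁ k` of the same arity, size and function, both in `ppolyCircuits (κ n)`, a schedule
`n^c ≤ κ n ≤ poly(n)` (eventually / always), `h n ≤ n`, polynomially bounded clear instances / names / answers,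
the EVENTUAL coin discipline, and a sub-exponentially secure iO `O` for `P/poly`: clause (C) for the obfuscations of
`C₁` implies clause (C) for the obfuscations of `C₀`. [cite: BitanskyPanethRosen2015, Def. 4.1] -/
theorem stub_bestPossibleStep' :
    ∀ (ε : ℝ) (O : CircuitObfuscator), 0 < ε → IsSubexpIO ε ppolyCircuits O →
    ∀ (κ h : ℕ → ℕ) (m : List Bool → ℕ) (C₀ C₁ : (k : List Bool) → Circuit (Fin (m k)))
      (nm ans : List Bool → List Bool),
      (∃ c : ℝ, 0 < c ∧ ∀ᶠ n : ℕ in atTop, (n : ℝ) ^ c ≤ κ n) →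
      (∃ p : Polynomial ℕ, ∀ n, κ n ≤ p.eval n) → (∀ n, h n ≤ n) →
      (∃ q : Polynomial ℕ, ∀ s : List Bool, (genClear h m C₀ nm s).length + (genClear h m C₁ nm s).length +
          (keyed h ans s).length ≤ q.eval s.length) →
      (∀ s : List Bool,
          (⟨m (s.take (h s.length)), C₀ (s.take (h s.length))⟩ : SizedCircuit) ∈
              ppolyCircuits (κ s.length) ∧
          (⟨m (s.take (h s.length)), C₁ (s.take (h s.length))⟩ : SizedCircuit) ∈
              ppolyCircuits (κ s.length) ∧
          (C₀ (s.take (h s.length))).size = (C₁ (s.take (h s.length))).size ∧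
          (∀ x, (C₀ (s.take (h s.length))).eval x = (C₁ (s.take (h s.length))).eval x)) →
      (∃ n₀ : ℕ, ∀ s : List Bool, n₀ ≤ s.length →
          O.coins (κ s.length) (C₀ (s.take (h s.length))) ≤ s.length - h s.length ∧
          O.coins (κ s.length) (C₁ (s.take (h s.length))) ≤ s.length - h s.length) →
      ClauseC (genObf O κ h m C₁ nm) (keyed h ans) →
      ClauseC (genObf O κ h m C₀ nm) (keyed h ans) := by
  intro ε O hε hO κ h m C₀ C₁ nm ans hκlo hκhi hh hq hpair hcoins hC1
  rw [clauseC_iff] at hC1 ⊢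
  intro A hA
  obtain ⟨q, hq⟩ := hq
  obtain ⟨n₀, hcoins⟩ := hcoins
  have hcoins₀ : ∀ n, n₀ ≤ n → ∀ k : List Bool, k.length = h n → O.coins (κ n) (C₀ k) ≤ n - h n :=
    fun n hn k hk => of_seed_ge (P := fun n k => O.coins (κ n) (C₀ k) ≤ n - h n) hh
      (fun s hs => (hcoins s hs).1) hn hk
  have hcoins₁ : ∀ n, n₀ ≤ n → ∀ k : List Bool, k.length = h n → O.coins (κ n) (C₁ k) ≤ n - h n :=
    fun n hn k hk => of_seed_ge (P := fun n k => O.coins (κ n) (C₁ k) ≤ n - h n) hh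
      (fun s hs => (hcoins s hs).2) hn hk
  -- (1) normalise `A`
  obtain ⟨pA, hpA⟩ := hA.2
  set A₁ : RandAlg (List Bool) (List Bool) := CoinNormalisation.norm A pA with hA₁def
  have hA₁ : IsPPT A₁ id := CoinNormalisation.isPPT_norm hA pA
  have hstab : ∀ (x : List Bool) (E : Set (List Bool)) (N : ℕ), A₁.coinLen x.length ≤ N →
      uniformProb N {ρ | A₁.run x ρ ∈ E} = A₁.pr id x E :=
    fun x E N hN => CoinNormalisation.uniformProb_norm_of_le A pA x E hN
  have hB : ∀ L, A₁.coinLen L ≤ (2 * pA + 1 : Polynomial ℕ).eval L := CoinNormalisation.norm_coinLen_le A pA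
  -- (2) the per-key gap bound, eventually in `n`, uniformly in `k`
  have hgap := eventually_ioAdvantageAdv_le hε hO κ h m C₀ C₁ nm ans hκlo
    ⟨q, fun n k hk => by
      have := of_seed (P := fun n k => (nm k).length + (ans k).length ≤ q.eval n) hh (fun s => by
        have h1 := hq s
        simp only [genClear, keyed, length_boolPair] at h1
        omega) hk
      exact this⟩
    (fun n k hk => of_seed (P := fun n k =>
        (⟨m k, C₀ k⟩ : SizedCircuit) ∈ ppolyCircuits (κ n) ∧ (⟨m k, C₁ k⟩ : SizedCircuit) ∈ ppolyCircuits (κ n) ∧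
          (C₀ k).size = (C₁ k).size ∧ (∀ x, (C₀ k).eval x = (C₁ k).eval x)) hh
      (fun s => hpair s) hk)
    hA₁ (2 * pA + 1)
  -- (3) hence the gap of the success sequences of `A₁`
  have hdiff : ∀ᶠ n : ℕ in atTop,
      |succ O κ h m C₀ nm ans A₁ n - succ O κ h m C₁ nm ans A₁ n| ≤ (2 : ℝ) ^ (-((κ n : ℝ) ^ ε)) := by
    filter_upwards [hgap, eventually_ge_atTop n₀] with n hn hn₀
    rw [succ_eq_key_coins O κ h m C₀ nm ans A₁ hh n (hcoins₀ n hn₀),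
      succ_eq_key_coins O κ h m C₁ nm ans A₁ hh n (hcoins₁ n hn₀)]
    refine SeedLaw.abs_uniformAvg_sub_le fun k hk => ?_
    rw [gap_eq_ioAdvantageAdv O hstab hB κ m C₀ C₁ nm ans n k]
    exact hn k hk
  -- (4) `2^{-(κ n)^ε} ≤ 2^{-n^{cε}}` eventually, and the latter is negligible
  obtain ⟨c, hc, hev⟩ := hκlo
  have hδ : SuperpolynomialDecay atTop (fun n : ℕ => (n : ℝ)) fun n : ℕ => (2 : ℝ) ^ (-((n : ℝ) ^ (c * ε))) :=
    superpolynomialDecay_two_rpow_neg (mul_pos hc hε)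
  have hδle : ∀ᶠ n : ℕ in atTop, (2 : ℝ) ^ (-((κ n : ℝ) ^ ε)) ≤ (2 : ℝ) ^ (-((n : ℝ) ^ (c * ε))) := by
    filter_upwards [hev] with n hn
    have h1 : ((n : ℝ) ^ c) ^ ε ≤ (κ n : ℝ) ^ ε := Real.rpow_le_rpow (by positivity) hn hε.le
    rw [← Real.rpow_mul (Nat.cast_nonneg n)] at h1
    exact Real.rpow_le_rpow_of_exponent_le one_le_two (neg_le_neg h1)
  -- (5) `succ C₀ A₁` decays
  have h1 : SuperpolynomialDecay atTop (fun n : ℕ => (n : ℝ)) (succ O κ h m C₀ nm ans A₁) := by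
    refine ((hC1 A₁ hA₁).add hδ).trans_eventually_abs_le ?_
    filter_upwards [hdiff, hδle] with n hn hn'
    simp only [Function.comp_apply, Pi.add_apply]
    rw [abs_of_nonneg (succ_nonneg _ _ _ _ _ _ _ _ _),
      abs_of_nonneg (add_nonneg (succ_nonneg _ _ _ _ _ _ _ _ _) (by positivity))]
    have := (abs_sub_le_iff.1 hn).1
    linarith
  -- (6) `succ C₀ A ≤ poly · succ C₀ A₁`
  obtain ⟨P, hP⟩ := exists_poly_length_inst hO.isEfficient κ h m C₀ nm hκhi hh
    ⟨q, fun s => le_trans (by omega) (hq s)⟩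
  let L : Polynomial ℕ := 2 * pA.comp P + 2
  have hdom : ∀ n, n₀ ≤ n →
      succ O κ h m C₀ nm ans A n ≤ ((L.eval n : ℕ) : ℝ) * succ O κ h m C₀ nm ans A₁ n := by
    intro n hn₀
    rw [succ_eq_key_coins O κ h m C₀ nm ans A hh n (hcoins₀ n hn₀),
      succ_eq_key_coins O κ h m C₀ nm ans A₁ hh n (hcoins₀ n hn₀), ← SeedLaw.uniformAvg_const_mul]
    refine SeedLaw.uniformAvg_mono fun k hk => ?_
    rw [← SeedLaw.uniformAvg_const_mul]
    refine SeedLaw.uniformAvg_mono fun r hr => ?_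
    refine (CoinNormalisation.pr_le_two_pow_mul A pA _ _ (hpA _)).trans ?_
    refine mul_le_mul_of_nonneg_right ?_ (RandAlg.pr_nonneg _ _ _ _)
    refine (CoinNormalisation.two_pow_width_le pA _).trans ?_
    have hlen : (xInst O κ m C₀ nm n k r).length ≤ P.eval n :=
      hP n k r hk (hr.le.trans ((hcoins₀ n hn₀ k hk).trans (Nat.sub_le _ _)))
    have : pA.eval (xInst O κ m C₀ nm n k r).length ≤ pA.eval (P.eval n) := SeedLaw.natPoly_eval_mono _ hlen
    have : (2 * pA.eval (xInst O κ m C₀ nm n k r).length + 2 : ℝ) ≤ ((L.eval n : ℕ) : ℝ) := by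
      simp only [L, eval_add, eval_mul, eval_ofNat, eval_comp]
      exact_mod_cast (by omega : 2 * pA.eval (xInst O κ m C₀ nm n k r).length + 2 ≤ 2 * pA.eval (P.eval n) + 2)
    exact this
  -- (7) conclude
  have h2 : SuperpolynomialDecay atTop (fun n : ℕ => (n : ℝ))
      (fun n : ℕ => ((L.map (Nat.castRingHom ℝ)).eval (n : ℝ)) * succ O κ h m C₀ nm ans A₁ n) :=
    h1.polynomial_mul _
  refine h2.trans_eventually_abs_le ?_
  filter_upwards [eventually_ge_atTop n₀] with n hn₀
  simp only [Function.comp_apply, Polynomial.eval_natCast_map, Nat.coe_castRingHom, Nat.cast_id]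
  rw [abs_of_nonneg (succ_nonneg _ _ _ _ _ _ _ _ _),
    abs_of_nonneg (mul_nonneg (Nat.cast_nonneg _) (succ_nonneg _ _ _ _ _ _ _ _ _))]
  exact hdom n hn₀

end BestPossibleStep

/-- **STUB `stub_bestPossibleStep`** (registered name and signature). [cite: BitanskyPanethRosen2015, Def. 4.1] -/
theorem stub_bestPossibleStep :
    ∀ (ε : ℝ) (O : CircuitObfuscator), 0 < ε → IsSubexpIO ε ppolyCircuits O →
    ∀ (κ h : ℕ → ℕ) (m : List Bool → ℕ) (C₀ C₁ : (k : List Bool) → Circuit (Fin (m k)))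
      (nm ans : List Bool → List Bool),
      (∃ c : ℝ, 0 < c ∧ ∀ᶠ n : ℕ in atTop, (n : ℝ) ^ c ≤ κ n) →
      (∃ p : Polynomial ℕ, ∀ n, κ n ≤ p.eval n) → (∀ n, h n ≤ n) →
      (∃ q : Polynomial ℕ, ∀ s : List Bool, (genClear h m C₀ nm s).length + (genClear h m C₁ nm s).length +
          (keyed h ans s).length ≤ q.eval s.length) →
      (∀ s : List Bool,
          (⟨m (s.take (h s.length)), C₀ (s.take (h s.length))⟩ : SizedCircuit) ∈
              ppolyCircuits (κ s.length) ∧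
          (⟨m (s.take (h s.length)), C₁ (s.take (h s.length))⟩ : SizedCircuit) ∈
              ppolyCircuits (κ s.length) ∧
          (C₀ (s.take (h s.length))).size = (C₁ (s.take (h s.length))).size ∧
          (∀ x, (C₀ (s.take (h s.length))).eval x = (C₁ (s.take (h s.length))).eval x)) →
      (∃ n₀ : ℕ, ∀ s : List Bool, n₀ ≤ s.length →
          O.coins (κ s.length) (C₀ (s.take (h s.length))) ≤ s.length - h s.length ∧
          O.coins (κ s.length) (C₁ (s.take (h s.length))) ≤ s.length - h s.length) →
      ClauseC (genObf O κ h m C₁ nm) (keyed h ans) →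
      ClauseC (genObf O κ h m C₀ nm) (keyed h ans) :=
  BestPossibleStep.stub_bestPossibleStep'

end Summit.QuantumAdvantage.QuantumAdvantage.Theorems.WbwObfuscatedGluedTrees.KnowledgeOfWalk
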